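import Mathlib
import Summits.KontsevichZagierPeriods.KontsevichZagierPeriods.Theses.InverseLandau
import Literature.NumberTheory.Transcendental.KZCalculus
import Literature.NumberTheory.Transcendental.SemialgebraicMaps
import Summits.KontsevichZagierPeriods.KontsevichZagierPeriods.Theorems.HermiteRigidityGenusTwoCycleTransferPushforwardDimOne

/-!
# `TateLifting` (stmt-KontsevichZagierPeriods-9129), line `Sketch` — stub 72 `realPeriodSwap`:
# the real-period swap on `y² = 4x³ − 28x + 24` is ONE change of variables

The elliptic curve `y² = 4x³ − 28x + 24 = 4(x − 1)(x − 2)(x + 3)` has the real branch points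
`−3 < 1 < 2 (< ∞)`, and its two real half-periods are the integrals of
`f(x) = (4x³ − 28x + 24)^(−1/2)` over `(2, ∞)` and over `(−3, 1)`. We prove that for ANY two
Kontsevich–Zagier integral representations `r = [(2, ∞), f]`, `r' = [(−3, 1), f]` (domains
`{x | 2 < x 0}` and `{x | x 0 ∈ Ioo (−3) 1}` of `ℝ¹ = Fin 1 → ℝ`, integrands agreeing with `f` on
them) one has `KZ.Equivalent r r'`, i.e. `[r] − [r'] ∈ KZ.relations`, and in fact
`[r] − [r'] ∈ KZ.changeOfVariablesRel` is ONE instance of rule (2) of the calculus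
(`tateLifting_realPeriodSwap`; verbatim the open item `LowdimRealPeriodSwap`,
stmt-KontsevichZagierPeriods-8773, of route LowDimension).

The substitution is the `ℚ`-rational Möbius INVOLUTION `Φ(x) = (x − 5)/(x − 1)` (the action of the
`2`-torsion translation by `(1, 0)` on the `x`-line), read on `ℝ¹` as `x ↦ (Φ (x 0))`:

* `Φ ∘ Φ = id` off the pole `x = 1` (`moebius_moebius`), so `Φ` is injective on `(2, ∞)`;
* `Φ` maps `(2, ∞)` into `(−3, 1)` and `(−3, 1)` into `(2, ∞)` (sign computations,
  `moebius_mem_Ioo`, `two_lt_moebius`), hence `Φ '' (2, ∞) = (−3, 1)` (`image_moebius`);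
* `Φ' = 4/(x − 1)²`, so the self-map of `ℝ¹` has derivative `(4/(x 0 − 1)²) • id`, of determinant
  `4/(x 0 − 1)²` (`hasFDerivAt_fin_one`, `det_smul_id_fin_one`);
* `Φ − 1 = −4/(x − 1)`, `Φ − 2 = −(x + 3)/(x − 1)`, `Φ + 3 = 4(x − 2)/(x − 1)`, whence the KEY
  IDENTITY `4Φ³ − 28Φ + 24 = (4x³ − 28x + 24) · (4/(x − 1)²)²` (`cubic_moebius`, `field_simp; ring`)
  and the Jacobian identity `f(x) = f(Φ x) · |Φ'(x)|` on `(2, ∞)` (`rpow_negHalf_mul_sq`: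
  `(A c²)^(−1/2) · c = A^(−1/2)` for `A ≥ 0`, `c > 0`);
* `Φ` is a `ℚ`-semialgebraic map on the domain (quotient of `ℚ`-polynomials with non-vanishing
  denominator, `isSemialgebraicFunOn_aeval_div_aeval`).

Integrability is carried by the fields of the given representations; no definition is introduced.
Pattern of `…/BetaCancellation/Negative/PiLinkReps.lean` (move 1) and
`HermiteRigidityGenusTwoCycleTransferPushforwardDimOne.lean`.

References: M. Kontsevich, D. Zagier, *Periods* (2001), §1.2 rule (2); E. T. Whittaker,
G. N. Watson, *A Course of Modern Analysis* (1927), §20.32.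
-/

noncomputable section

open MeasureTheory Set
open Literature.NumberTheory.Transcendental
open Literature.ModelTheory.ExponentialFields (IsSemialgebraic)
open MvPolynomial (X C aeval)
open Summit.KontsevichZagierPeriods.HermiteRigidity.GenusTwoCycleTransfer
  (det_smul_id_fin_one hasFDerivAt_fin_one)

namespace Summit.KontsevichZagierPeriods.InverseLandau

namespace RealPeriodSwap

/-! ### Algebra of the Möbius involution `Φ(t) = (t − 5)/(t − 1)` -/

/-- `Φ(t) − 1 = −4/(t − 1)` off the pole. [folklore] -/
theorem moebius_sub_one {t : ℝ} (ht : t - 1 ≠ 0) : (t - 5) / (t - 1) - 1 = -4 / (t - 1) := by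
  field_simp
  ring

/-- `Φ(t) − 5 = −4t/(t − 1)` off the pole. [folklore] -/
theorem moebius_sub_five {t : ℝ} (ht : t - 1 ≠ 0) :
    (t - 5) / (t - 1) - 5 = -4 * t / (t - 1) := by
  field_simp
  ring

/-- `Φ` is an involution off the pole: `Φ (Φ t) = t` for `t ≠ 1`. [folklore] -/
theorem moebius_moebius {t : ℝ} (ht : t - 1 ≠ 0) :
    ((t - 5) / (t - 1) - 5) / ((t - 5) / (t - 1) - 1) = t := by
  rw [moebius_sub_five ht, moebius_sub_one ht]
  field_simp

/-- `Φ` maps `(2, ∞)` into `(−3, 1)`. [folklore] -/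
theorem moebius_mem_Ioo {t : ℝ} (ht : 2 < t) : (t - 5) / (t - 1) ∈ Ioo (-3 : ℝ) 1 := by
  have h1 : 0 < t - 1 := by linarith
  refine ⟨?_, ?_⟩
  · rw [lt_div_iff₀ h1]
    linarith
  · rw [div_lt_iff₀ h1]
    linarith

/-- `Φ` maps `(−3, 1)` into `(2, ∞)`. [folklore] -/
theorem two_lt_moebius {y : ℝ} (hy : y ∈ Ioo (-3 : ℝ) 1) : 2 < (y - 5) / (y - 1) := by
  have h1 : y - 1 < 0 := by linarith [hy.2]
  rw [lt_div_iff_of_neg h1]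
  linarith [hy.1]

/-- The image identity `Φ '' (2, ∞) = (−3, 1)` on `ℝ¹` (`⊆` by the sign computations, `⊇` because
`Φ` is an involution exchanging the two intervals). [folklore] -/
theorem image_moebius :
    (fun x : Fin 1 → ℝ => fun _ : Fin 1 => (x 0 - 5) / (x 0 - 1)) '' {x | 2 < x 0} =
      {x | x 0 ∈ Ioo (-3 : ℝ) 1} := by
  ext y
  constructor
  · rintro ⟨x, hx, rfl⟩
    exact moebius_mem_Ioo hx
  · intro hy
    have hy1 : y 0 < 1 := hy.2
    refine ⟨fun _ => (y 0 - 5) / (y 0 - 1), two_lt_moebius hy, ?_⟩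
    funext i
    obtain rfl : i = 0 := Fin.fin_one_eq_zero i
    exact moebius_moebius (sub_ne_zero.2 hy1.ne)

/-- The cubic is positive on `(2, ∞)`: `4t³ − 28t + 24 = 4(t − 1)(t − 2)(t + 3) > 0`. [folklore] -/
theorem cubic_pos {t : ℝ} (ht : 2 < t) : 0 < 4 * t ^ 3 - 28 * t + 24 := by
  have h : 4 * t ^ 3 - 28 * t + 24 = 4 * (t - 1) * (t - 2) * (t + 3) := by ring
  rw [h]
  have h1 : 0 < t - 1 := by linarith
  have h2 : 0 < t - 2 := by linarith
  have h3 : 0 < t + 3 := by linarith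
  positivity

/-- **The key identity** `4Φ³ − 28Φ + 24 = (4t³ − 28t + 24) · (4/(t − 1)²)²` (i.e.
`f(Φ t) = f(t) · Φ'(t)²` for `f = 4x³ − 28x + 24`). [folklore] -/
theorem cubic_moebius {t : ℝ} (ht : t - 1 ≠ 0) :
    4 * ((t - 5) / (t - 1)) ^ 3 - 28 * ((t - 5) / (t - 1)) + 24 =
      (4 * t ^ 3 - 28 * t + 24) * (4 / (t - 1) ^ 2) ^ 2 := by
  field_simp
  ring

/-- `(A c²)^(−1/2) · c = A^(−1/2)` for `A ≥ 0`, `c > 0` (the rpow bookkeeping of the Jacobian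
identity). [folklore] -/
theorem rpow_negHalf_mul_sq {A c : ℝ} (hA : 0 ≤ A) (hc : 0 < c) :
    (A * c ^ 2) ^ (-(1 : ℝ) / 2) * c = A ^ (-(1 : ℝ) / 2) := by
  have h2 : (c ^ 2) ^ (-(1 : ℝ) / 2) = c⁻¹ := by
    rw [show (c ^ 2 : ℝ) = c ^ ((2 : ℕ) : ℝ) from (Real.rpow_natCast c 2).symm,
      ← Real.rpow_mul hc.le, show ((2 : ℕ) : ℝ) * (-(1 : ℝ) / 2) = -1 by norm_num,
      Real.rpow_neg_one]
  rw [Real.mul_rpow hA (sq_nonneg c), h2, mul_assoc, inv_mul_cancel₀ hc.ne', mul_one]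

/-- The Möbius map `x ↦ (Φ (x 0))` of `ℝ¹` is a `ℚ`-semialgebraic map on every `ℚ`-semialgebraic
set missing the pole `{x 0 = 1}` (quotient of `ℚ`-polynomials with non-vanishing denominator).
[cite: BochnakCosteRoy1998, Prop. 2.2.6] -/
theorem isSemialgebraicMapOn_moebius {s : Set (Fin 1 → ℝ)} (hs : IsSemialgebraic ℚ s)
    (h1 : ∀ x ∈ s, x 0 - 1 ≠ 0) :
    IsSemialgebraicMapOn ℚ s (fun x : Fin 1 → ℝ => fun _ : Fin 1 => (x 0 - 5) / (x 0 - 1)) := by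
  refine IsSemialgebraicMapOn.of_forall hs fun _ => ?_
  have hq : ∀ x ∈ s, aeval x (X 0 - 1 : MvPolynomial (Fin 1) ℚ) ≠ 0 := fun x hx => by
    simpa using h1 x hx
  refine (isSemialgebraicFunOn_aeval_div_aeval hs (X 0 - 5 : MvPolynomial (Fin 1) ℚ)
    (X 0 - 1) hq).congr fun x _ => ?_
  simp

end RealPeriodSwap

open RealPeriodSwap

/-- **Stub 72 `realPeriodSwap`** (= item `LowdimRealPeriodSwap`, stmt-KontsevichZagierPeriods-8773, of
route LowDimension, verbatim): on `y² = 4x³ − 28x + 24` (real roots `−3 < 1 < 2`) the two real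
half-period representations `[(2, ∞), (4x³ − 28x + 24)^(−1/2)]` and
`[(−3, 1), (4x³ − 28x + 24)^(−1/2)]` are KZ-equivalent, by ONE change of variables
(`KZ.changeOfVariablesRel`) along the `2`-torsion translation `Φ(x) = (x − 5)/(x − 1)`:
`Φ` is a `ℚ`-semialgebraic injective map of `(2, ∞)` onto `(−3, 1)` with `Φ' = 4/(x − 1)²` and
`f(x) = f(Φ x) · |Φ'(x)|` for `f = (4x³ − 28x + 24)^(−1/2)`.
[cite: KontsevichZagier2001, §1.2 rule (2)] -/
theorem tateLifting_realPeriodSwap :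
    ∀ (r r' : KZ.IntegralRep 1), r.domain = {x | 2 < x 0} → Set.EqOn r.integrand (fun x => (4 * (x 0) ^ 3 - 28 * x 0 + 24) ^ (-(1:ℝ)/2)) r.domain → r'.domain = {x | x 0 ∈ Set.Ioo (-3:ℝ) 1} → Set.EqOn r'.integrand (fun x => (4 * (x 0) ^ 3 - 28 * x 0 + 24) ^ (-(1:ℝ)/2)) r'.domain → KZ.Equivalent r r' := by
  intro r r' hrd hr hr'd hr'
  have hpole : ∀ x ∈ r.domain, x 0 - 1 ≠ 0 := fun x hx => by
    rw [hrd] at hx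
    simp only [mem_setOf_eq] at hx
    linarith
  refine KZ.changeOfVariablesRel_subset_relations
    ⟨1, r, r', fun x _ => (x 0 - 5) / (x 0 - 1),
      fun x => (4 / (x 0 - 1) ^ 2) • ContinuousLinearMap.id ℝ (Fin 1 → ℝ),
      isSemialgebraicMapOn_moebius r.isSemialgebraic_domain hpole, fun x hx => ?_,
      fun x hx y hy hxy => ?_, by rw [hr'd, hrd, image_moebius], fun x hx => ?_, rfl⟩
  · -- the derivative within the domain
    have hd : HasDerivAt (fun t : ℝ => (t - 5) / (t - 1)) (4 / (x 0 - 1) ^ 2) (x 0) := by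
      refine (((hasDerivAt_id' (x 0)).sub_const 5).div ((hasDerivAt_id' (x 0)).sub_const 1)
        (hpole x hx)).congr_deriv ?_
      ring
    exact (hasFDerivAt_fin_one _ _ x hd).hasFDerivWithinAt
  · -- injectivity: `Φ` is an involution
    have h0 : (x 0 - 5) / (x 0 - 1) = (y 0 - 5) / (y 0 - 1) := congrFun hxy 0
    funext i
    obtain rfl : i = 0 := Fin.fin_one_eq_zero i
    rw [← moebius_moebius (hpole x hx), h0, moebius_moebius (hpole y hy)]
  · -- the Jacobian identity on the domain
    have hx2 : 2 < x 0 := by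
      rw [hrd] at hx
      exact hx
    have hc : 0 < 4 / (x 0 - 1) ^ 2 := by
      have := hpole x hx
      positivity
    have hΦ : (fun _ : Fin 1 => (x 0 - 5) / (x 0 - 1)) ∈ r'.domain := by
      rw [hr'd]
      exact moebius_mem_Ioo hx2
    have e1 : r.integrand x = (4 * (x 0) ^ 3 - 28 * x 0 + 24) ^ (-(1:ℝ)/2) := hr hx
    have e2 : r'.integrand (fun _ : Fin 1 => (x 0 - 5) / (x 0 - 1)) =
        (4 * ((x 0 - 5) / (x 0 - 1)) ^ 3 - 28 * ((x 0 - 5) / (x 0 - 1)) + 24) ^ (-(1:ℝ)/2) :=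
      hr' hΦ
    show r.integrand x = r'.integrand (fun _ : Fin 1 => (x 0 - 5) / (x 0 - 1)) *
      |((4 / (x 0 - 1) ^ 2) • ContinuousLinearMap.id ℝ (Fin 1 → ℝ)).det|
    rw [e1, e2, det_smul_id_fin_one, abs_of_pos hc, cubic_moebius (hpole x hx),
      rpow_negHalf_mul_sq (cubic_pos hx2).le hc]

end Summit.KontsevichZagierPeriods.InverseLandau

end
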